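import Summits.CriticalPhenomena.PercolationContinuityZ3.Theorems.PercNearOneGluingNoHeavyQuantShapePieceBlob
import Summits.CriticalPhenomena.PercolationContinuityZ3.Theorems.PercNearOneGluingNoHeavyQuantPieceBlobLongBasePB1
import Summits.CriticalPhenomena.PercolationContinuityZ3.Theorems.PercNearOneGluingNoHeavyQuantPieceBlobLongBasePD1
import Summits.CriticalPhenomena.PercolationContinuityZ3.Theorems.PercNearOneGluingNoHeavyQuantPieceBlobLongBasePD2x
import Summits.CriticalPhenomena.PercolationContinuityZ3.Theorems.PercNearOneGluingNoHeavyQuantPieceBlobLongBasePE1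
import Summits.CriticalPhenomena.PercolationContinuityZ3.Theorems.PercNearOneGluingNoHeavyQuantPieceBlobLongBasePC1a
import Summits.CriticalPhenomena.PercolationContinuityZ3.Theorems.PercNearOneGluingNoHeavyQuantPieceBlobLongBasePC1b
import Summits.CriticalPhenomena.PercolationContinuityZ3.Theorems.PercNearOneGluingNoHeavyQuantPieceBlobLongBasePC1c
import Summits.CriticalPhenomena.PercolationContinuityZ3.Theorems.PercNearOneGluingNoHeavyQuantPieceBlobLongBasePE2
import HarnessLib

/-!
# QUANT lane R8, T-DEC: THE PIECE BESIDE A BIG BLOB FOR EVERY SHAPE `lo < K ≤ 4lo` AND EVERY GATE — the base bricks on the whole range `lo ≤ K ≤ 4lo` (census-1 gen 33)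

builds on p205010 (kernel theorem, internal audit signed; external expert review pending)

Support file (`--supports stmt-CriticalPhenomena-4575`), QUANT lane seat prim-quant-census-1 (gen 33); memo
`run/shared/lean/prim/quant/prim-quant-census-1/g33/WIDE3-G33.md` §4.  Theorems only, standard axioms, no sorries.  This file: the case splits `pb_PB1`, `pb_PD1`, `pb_PD2x`, `pb_PE1`, `pb_PC1a/b/c`, `pb_PE2` over the three shape boxes.
THE RULE (memo §4; exact regression `g33/code/exp6_pieceblob_rule.py`, 0 failures on 13 shapes `lo < K ≤ 4lo`): per outer gate, the low atom `lo` of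
`S(γ) ∗ blob_{lo+K}(g)` goes to `2lo+K` while `θ₁(ν(lo)+ν(2lo+K)) ≤ ν(2lo+K)` (`θ₁ = max(y, D/(lo+K))`, `D = T − 2lo`); otherwise the flow
SPLITS — `a(1−γ)g(lo+K−D)/D` saturates `2lo+K`, the overflow `a(1−γ)(D−(lo+K)g)/D` goes to the top; for `D ≥ lo+K` everything goes to the top.
Bricks (polynomial inequalities in `lo, K, γ, g, D` (and `y`/`x`), K-units `c = lo/K ∈ [1/4, 1]` split into the boxes `[1/4,1/3]`, `[1/3,1/2]`, `[1/2,1]`):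
PB1/PB2 (top capacity of the overflow: ρ / floor), PC1a–c / PC2a–c (split cost: ρ / floor regime, three budget sub-cases), PD1/PD2 (top capacity,
regime II), PE1/PE2 (top cost, regime II); the floor-regime bricks are certified at the floor bound `ȳ = (2lo+D)·x_max/T₀` (`…GD` / `…XD` for
`x_max = g` / `(lo+Kγ)/(lo+K)`) and transported to every `y ≤ ȳ` by monotonicity (`pb_glue_cap`, `pb_glue_cost`).  Certificates: Handelman products found
by kit (`g33/code/kitjob6`: scipy/HiGHS dual simplex for the support + exact rational repair), checked here by `linarith`.

HONEST STATUS.  Algebra only.  `SiblingStep`, `GluedDominatedMass`, `SDECConvClosed`, `FarTreeRow` OPEN; RATE class (log\*) / honest sentence of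
`run/shared/lean/prim/quant/README.md` unchanged.  [this work].  Nothing here is cited as a published result.  The gluing rows served
[cite: KozmaNitzan2024, Conjecture 3 (p. 15)]; product measure [cite: Grimmett1999, §1.3 p. 10].
-/

noncomputable section

open scoped BigOperators

namespace Summit.CriticalPhenomena.PercolationContinuityZ3.Theorems
namespace Quant
namespace LawDec

/-- brick PB1 on the whole range (case split over the three shape boxes). [this work] -/
theorem pb_PB1 (lo K γ g : ℝ) (hlo : 0 < lo) (hK1 : lo ≤ K) (hK4 : K ≤ 4 * lo)
    (hγ : lo ≤ K * γ) (hγ1 : γ ≤ 1) (hbig : 2 * lo ≤ (lo + K) * g) (hg1 : g ≤ 1) :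
    (K * γ - lo + (lo + K) * g) * ((1 - γ) + γ * g)
      ≤ g * ((lo + K) * (1 - γ) + (lo + 2 * K) * γ) := by
  rcases le_total K (2 * lo) with hK2' | hK2
  · exact pbC_PB1 lo K γ g hlo hK1 hK2' hγ hγ1 hbig hg1
  · rcases le_total K (3 * lo) with hK3' | hK3
    · exact pbB_PB1 lo K γ g hlo hK2 hK3' hγ hγ1 hbig hg1
    · exact pbA_PB1 lo K γ g hlo hK3 hK4 hγ hγ1 hbig hg1

/-- brick PD1 on the whole range (case split over the three shape boxes). [this work] -/
theorem pb_PD1 (lo K γ g D : ℝ) (hlo : 0 < lo) (hK1 : lo ≤ K) (hK4 : K ≤ 4 * lo)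
    (hγ : lo ≤ K * γ) (hγ1 : γ ≤ 1) (hbig : 2 * lo ≤ (lo + K) * g) (hg1 : g ≤ 1) (hDB' : lo + K ≤ D) (hDmax' : D ≤ (K * γ - lo + (lo + K) * g)) :
    D * (((1 - γ) * (1 - g)) + (γ * g))
      ≤ (lo + 2 * K) * (γ * g) := by
  rcases le_total K (2 * lo) with hK2' | hK2
  · exact pbC_PD1 lo K γ g D hlo hK1 hK2' hγ hγ1 hbig hg1 hDB' hDmax'
  · rcases le_total K (3 * lo) with hK3' | hK3
    · exact pbB_PD1 lo K γ g D hlo hK2 hK3' hγ hγ1 hbig hg1 hDB' hDmax'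
    · exact pbA_PD1 lo K γ g D hlo hK3 hK4 hγ hγ1 hbig hg1 hDB' hDmax'

/-- brick PD2x on the whole range (case split over the three shape boxes). [this work] -/
theorem pb_PD2x (lo K γ g x : ℝ) (hlo : 0 < lo) (hK1 : lo ≤ K) (hK4 : K ≤ 4 * lo)
    (hγ : lo ≤ K * γ) (hγ1 : γ ≤ 1) (hbig : 2 * lo ≤ (lo + K) * g) (hg1 : g ≤ 1) (hx0 : 0 ≤ x) (hxg' : x ≤ g) (hxB' : (lo + K) * x ≤ lo + K * γ) (hDmaxB' : lo + K ≤ (K * γ - lo + (lo + K) * g)) :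
    x * (((1 - γ) * (1 - g)) + (γ * g))
      ≤ (γ * g) := by
  rcases le_total K (2 * lo) with hK2' | hK2
  · exact pbC_PD2x lo K γ g x hlo hK1 hK2' hγ hγ1 hbig hg1 hDmaxB' hx0 hxg' hxB'
  · rcases le_total K (3 * lo) with hK3' | hK3
    · exact pbB_PD2x lo K γ g x hlo hK2 hK3' hγ hγ1 hbig hg1 hDmaxB' hx0 hxg' hxB'
    · exact pbA_PD2x lo K γ g x hlo hK3 hK4 hγ hγ1 hbig hg1 hDmaxB' hx0 hxg' hxB'

/-- brick PE1 on the whole range (case split over the three shape boxes). [this work] -/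
theorem pb_PE1 (lo K γ g D : ℝ) (hlo : 0 < lo) (hK1 : lo ≤ K) (hK4 : K ≤ 4 * lo)
    (_hγ : lo ≤ K * γ) (hγ1 : γ ≤ 1) (hbig : 2 * lo ≤ (lo + K) * g) (hg1 : g ≤ 1) (hDB' : lo + K ≤ D) (hDmax' : D ≤ (K * γ - lo + (lo + K) * g)) :
    (2 * K - D) * D * ((1 - γ) * (1 - g))
      ≤ (lo + 2 * K - D) * (((1 - γ) * (1 - g)) * (lo + D) + (γ * (1 - g)) * (lo + D - K) + ((1 - γ) * g) * (D - K)) := by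
  rcases le_total K (2 * lo) with hK2' | hK2
  · exact pbC_PE1 lo K γ g D hlo hK1 hK2' hγ1 hg1 hDB' hDmax'
  · rcases le_total K (3 * lo) with hK3' | hK3
    · exact pbB_PE1 lo K γ g D hlo hK2 hK3' hγ1 hg1 hDB' hDmax'
    · exact pbA_PE1 lo K γ g D hlo hK3 hK4 hγ1 hbig hg1 hDB' hDmax'

/-- brick PC1a on the whole range (case split over the three shape boxes). [this work] -/
theorem pb_PC1a (lo K γ g D : ℝ) (hlo : 0 < lo) (hK1 : lo ≤ K) (hK4 : K ≤ 4 * lo)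
    (_hγ : lo ≤ K * γ) (hγ1 : γ ≤ 1) (hbig : 2 * lo ≤ (lo + K) * g) (_hg1 : g ≤ 1) (hD : 0 ≤ D) (hDBg' : (lo + K) * g ≤ D) (hBD' : D ≤ lo + K) (_hDmax' : D ≤ (K * γ - lo + (lo + K) * g)) (hBT' : D ≤ K - lo) :
    (K - D) * ((1 - γ) * g) * (lo + 2 * K - D) + (2 * K - D) * (1 - γ) * (D - (lo + K) * g)
      ≤ (lo + 2 * K - D) * (((1 - γ) * (1 - g)) * (lo + D)) := by
  rcases le_total K (2 * lo) with hK2' | hK2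
  · exact pbC_PC1a lo K γ g D hlo hK1 hK2' hγ1 hbig hD hDBg' hBD' hBT'
  · rcases le_total K (3 * lo) with hK3' | hK3
    · exact pbB_PC1a lo K γ g D hlo hK2 hK3' hγ1 hbig hD hDBg' hBD' hBT'
    · exact pbA_PC1a lo K γ g D hlo hK3 hK4 hγ1 hD hDBg' hBD'

/-- brick PC1b on the whole range (case split over the three shape boxes). [this work] -/
theorem pb_PC1b (lo K γ g D : ℝ) (hlo : 0 < lo) (hK1 : lo ≤ K) (_hK4 : K ≤ 4 * lo)
    (hγ : lo ≤ K * γ) (hγ1 : γ ≤ 1) (hbig : 2 * lo ≤ (lo + K) * g) (hg1 : g ≤ 1) (hD : 0 ≤ D) (hDBg' : (lo + K) * g ≤ D) (hBD' : D ≤ lo + K) (_hDmax' : D ≤ (K * γ - lo + (lo + K) * g)) (hTB' : K ≤ lo + D) (hh1T' : D ≤ K) :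
    (K - D) * ((1 - γ) * g) * (lo + 2 * K - D) + (2 * K - D) * (1 - γ) * (D - (lo + K) * g)
      ≤ (lo + 2 * K - D) * (((1 - γ) * (1 - g)) * (lo + D) + (γ * (1 - g)) * (lo + D - K)) := by
  rcases le_total K (2 * lo) with hK2' | hK2
  · exact pbC_PC1b lo K γ g D hlo hK1 hγ hγ1 hbig hg1 hD hDBg' hBD' hTB' hh1T'
  · rcases le_total K (3 * lo) with hK3' | hK3
    · exact pbB_PC1b lo K γ g D hlo hK2 hγ hγ1 hbig hg1 hD hDBg' hBD' hTB' hh1T'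
    · exact pbA_PC1b lo K γ g D hlo hK3 hγ hγ1 hbig hg1 hD hDBg' hBD' hTB' hh1T'

/-- brick PC1c on the whole range (case split over the three shape boxes). [this work] -/
theorem pb_PC1c (lo K γ g D : ℝ) (hlo : 0 < lo) (hK1 : lo ≤ K) (hK4 : K ≤ 4 * lo)
    (hγ : lo ≤ K * γ) (hγ1 : γ ≤ 1) (_hbig : 2 * lo ≤ (lo + K) * g) (hg1 : g ≤ 1) (hD : 0 ≤ D) (hDBg' : (lo + K) * g ≤ D) (hBD' : D ≤ lo + K) (_hDmax' : D ≤ (K * γ - lo + (lo + K) * g)) (hTh1' : K ≤ D) :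
    (2 * K - D) * (1 - γ) * (D - (lo + K) * g)
      ≤ (lo + 2 * K - D) * (((1 - γ) * (1 - g)) * (lo + D) + (γ * (1 - g)) * (lo + D - K) + ((1 - γ) * g) * (D - K)) := by
  rcases le_total K (2 * lo) with hK2' | hK2
  · exact pbC_PC1c lo K γ g D hlo hK1 hK2' hγ hγ1 hg1 hD hDBg' hBD' hTh1'
  · rcases le_total K (3 * lo) with hK3' | hK3
    · exact pbB_PC1c lo K γ g D hlo hK2 hK3' hγ hγ1 hg1 hD hBD' hTh1'
    · exact pbA_PC1c lo K γ g D hlo hK3 hK4 hγ hγ1 hg1 hD hBD' hTh1'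

/-- brick PE2 on the whole range (case split over the three shape boxes). [this work] -/
theorem pb_PE2 (lo K γ g D y : ℝ) (hlo : 0 < lo) (hK1 : lo ≤ K) (hK4 : K ≤ 4 * lo)
    (hγ : lo ≤ K * γ) (hγ1 : γ ≤ 1) (hbig : 2 * lo ≤ (lo + K) * g) (hg1 : g ≤ 1) (hDB' : lo + K ≤ D) (hDmax' : D ≤ (K * γ - lo + (lo + K) * g)) (hy0 : 0 ≤ y) (hy1 : y ≤ 1) (hyL' : D ≤ y * (lo + 2 * K)) (hyg' : y * (lo + K * γ + (lo + K) * g) ≤ (2 * lo + D) * g) (hyB' : y * (lo + K * γ + (lo + K) * g) * (lo + K) ≤ (2 * lo + D) * (lo + K * γ)) :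
    (2 * K - D) * y * ((1 - γ) * (1 - g))
      ≤ (1 - y) * (((1 - γ) * (1 - g)) * (lo + D) + (γ * (1 - g)) * (lo + D - K) + ((1 - γ) * g) * (D - K)) := by
  rcases le_total K (2 * lo) with hK2' | hK2
  · exact pbC_PE2 lo K γ g D y hlo hK1 hK2' hγ hγ1 hbig hg1 hDB' hDmax' hy0 hy1 hyL' hyg' hyB'
  · rcases le_total K (3 * lo) with hK3' | hK3
    · exact pbB_PE2 lo K γ g D y hlo hK2 hK3' hγ hγ1 hbig hg1 hDB' hDmax' hy0 hy1 hyL' hyg' hyB'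
    · exact pbA_PE2 lo K γ g D y hlo hK3 hK4 hγ hγ1 hbig hg1 hDB' hDmax' hy0 hy1 hyL' hyg' hyB'

end LawDec
end Quant
end Summit.CriticalPhenomena.PercolationContinuityZ3.Theorems
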